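import Mathlib
import Summits.NavierStokesRegularity.NavierStokesRegularity.Theorems.EulerZoomLiouvillePowerGaugeEulerLiouvilleDistributionallyPolynomial
import Summits.NavierStokesRegularity.NavierStokesRegularity.Theorems.EulerZoomLiouvillePowerGaugeEulerLiouvilleAffineStrainMember
import HarnessLib

/-!
# Crux `EulerZoomLiouville.PowerGaugeEulerLiouville` (stmt-NavierStokesRegularity-19832), stub `stub_nonSelfSimilarRest`:
# VORTICITY / STRAIN / LAMB TERM POLYNOMIAL IN TIME in `𝒟'` on a past slab ⇒ TRIVIAL (any degree)

Helper file (theorems only; `--supports stmt-NavierStokesRegularity-19832`; def-free).  Hand leafhand-ns-eulerzoomliouville-10 g4; the polynomial-order roof of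
`…FrozenVorticityMember` / `…FrozenStrainMember` (hand g3, order 0), `…AffineVorticityMember` / `…AffineStrainMember` / `…FrozenLambMember` (hand 10 g4, order 1),
on top of `…DistributionallyPolynomial` (`∂ₜ^{N+1}u = 0` in `𝒟'` ⇒ trivial, hands 10 g4 + 11 g0).

* `TimeTested.integral_mul_inner_eq_zero_of_curlFree` / `…_of_symFree` — for ANY smooth cutoff `κ` compactly supported in `(−∞,T₁)`: if the time-tested
  field `∫ κ(t) u(t,·) dt` annihilates all curl pairs (resp. all symmetric pairs) then `∫∫ κ(t)⟪u, Φ⟫ = 0` for every continuous compactly supported `Φ`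
  (weakly curl-free resp. weak Killing + `A`-gauge growth ⇒ zero; hand g3's kills for `κ = θ'`, extracted for all `κ`).
* `Loc.ae_eq_zero_of_distributionallyPolynomialVorticityPast` — `∫∫ θ^{(N+1)}⟪u, (∂ₐg)c − (∂_c g)a⟫ = 0` (`∂ₜ^{N+1}ω = 0` in `𝒟'`) ⇒ trivial; `H`-form
  `…_of_polynomialWeakGradientCurl`.
* `Loc.ae_eq_zero_of_distributionallyPolynomialStrainPast` — `∂ₜ^{N+1}(H + Hᵀ) = 0` in `𝒟'` ⇒ trivial; `H`-form `…_of_polynomialWeakGradientSym`.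
* `Loc.ae_eq_zero_of_polynomialLambCurlPast` — velocity-tested advection polynomial of degree `≤ N` in `𝒟'` on curl pairs
  (`∫∫ θ^{(N+1)}⟪u, Dη[u]⟫ = 0`) ⇒ `∂ₜ^{N+2}ω = 0` in `𝒟'` (momentum identity tested with `θ^{(N+1)}η`) ⇒ trivial.
* Binder language `Birth.nonSelfSimilar_of_distributionallyPolynomialVorticityPast` / `…StrainPast` / `…_of_polynomialLambCurlPast`.

WHAT THIS IS NOT: not a proof of the stub or of the crux; nothing about Navier–Stokes. [folklore; MajdaBertozziCUP2002 §1.2, §2.4]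
-/

noncomputable section

-- flat `Theorems/<Route><Decl>…` files of one crux share the namespace of the crux (tree convention)
set_option linter.dupNamespace false

open MeasureTheory Set Filter Topology Metric Function TopologicalSpace
open scoped RealInnerProductSpace NNReal ENNReal ContDiff

namespace Summit.NavierStokesRegularity.NavierStokesRegularity.Theorems.PowerGaugeEulerLiouville

open Literature.Analysis Literature.Analysis.FunctionSpaces Literature.Analysis.FluidPDE

namespace TimeTested

variable {u : ℝ → EuclideanSpace ℝ (Fin 3) → EuclideanSpace ℝ (Fin 3)}

/-- **GROWTH OF A TIME-TESTED FIELD FROM THE `A`-GAUGE**, any smooth cutoff `κ` compactly supported in `(−∞,T₁)`, `T₁ ≤ 0`: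
`∫_{B_r} |∫ κ u|² ≤ K r^{1−2ρ}` for `r > r₀`. [folklore] -/
theorem growth_of_gaugeA {ρ : ℝ} {c : ℝ≥0}
    (hum : AEStronglyMeasurable (uncurry u) (volume.restrict (Iio (0 : ℝ) ×ˢ (univ : Set (EuclideanSpace ℝ (Fin 3))))))
    (hA : ∀ a : ℝ, 0 < a → ENNReal.ofReal (a ^ (2 * ρ)) * cknA a (0 : ℝ × EuclideanSpace ℝ (Fin 3)) u ≤ (c : ℝ≥0∞))
    {T₁ : ℝ} (hT₁ : T₁ ≤ 0) {κ : ℝ → ℝ} (hκ : Continuous κ) (hκc : HasCompactSupport κ) (hκT₁ : tsupport κ ⊆ Iio T₁) :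
    ∃ K r₀ : ℝ, ∀ r : ℝ, r₀ < r → 0 < r →
      ∫⁻ x in ball (0 : EuclideanSpace ℝ (Fin 3)) r, ‖∫ t, κ t • u t x‖ₑ ^ 2 ≤ ENNReal.ofReal (K * r ^ (1 - 2 * ρ)) := by
  -- adapted from Theorems/EulerZoomLiouvillePowerGaugeEulerLiouvilleWeakAntiEquivariantMember.lean (hand g3), for a general cutoff
  obtain ⟨M, hM⟩ := hκ.bounded_above_of_compact_support hκc
  obtain ⟨a₀, ha₀⟩ := hκc.isCompact.bddBelow
  set a : ℝ := min (a₀ - 1) (T₁ - 1) with hadef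
  have hab : a < T₁ := lt_of_le_of_lt (min_le_right _ _) (by linarith)
  have hκS : ∀ t ∉ Ioo a T₁, κ t = 0 := by
    intro t ht
    by_contra hne
    have hts : t ∈ tsupport κ := subset_tsupport _ hne
    exact ht ⟨lt_of_le_of_lt (min_le_left _ _) (by linarith [ha₀ hts]), hκT₁ hts⟩
  refine ⟨M ^ 2 * (T₁ - a) * ((T₁ - a) * c), |a| + 1, fun r hr hr0 => ?_⟩
  have hr1 : 1 < r := by
    have : (0 : ℝ) ≤ |a| := abs_nonneg a
    linarith
  have hra : -(r ^ 2) < a := by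
    have h1 : |a| < r := by linarith [abs_nonneg a]
    have h2 : r < r ^ 2 := by nlinarith
    have h3 : -|a| ≤ a := neg_abs_le a
    linarith
  have hB : ∀ t ∈ Ioo a T₁, ∫⁻ x in ball (0 : EuclideanSpace ℝ (Fin 3)) r, ‖u t x‖ₑ ^ 2 ≤
      ENNReal.ofReal ((c : ℝ) * r ^ (1 - 2 * ρ)) := fun t ht =>
    Backward.lintegral_ball_le_of_gaugeA hr0 (hA r hr0) ⟨by linarith [ht.1], lt_of_lt_of_le ht.2 hT₁⟩
  have h1 := AntiMember.lintegral_ball_timeTested_le hum hT₁ hκS hM hB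
  refine h1.trans (le_of_eq ?_)
  have hM0 : 0 ≤ M := (norm_nonneg _).trans (hM 0)
  have hTa : 0 ≤ T₁ - a := by linarith
  rw [← ENNReal.ofReal_mul (sq_nonneg M), ← ENNReal.ofReal_mul hTa, ← ENNReal.ofReal_mul (mul_nonneg (sq_nonneg M) hTa)]
  congr 1
  ring

/-- Incompressibility, time-tested with any smooth cutoff `κ` compactly supported in `(−∞,0)`: `∫∫ κ(t)⟪u, ∇g⟫ = 0`. [folklore] -/
theorem integral_mul_inner_gradient_eq_zero {p : ℝ → EuclideanSpace ℝ (Fin 3) → ℝ}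
    (hdist : IsDistributionalNSSolutionOn (slab (EuclideanSpace ℝ (Fin 3)) (Iio 0) isOpen_Iio) 0 0 u p)
    {κ : ℝ → ℝ} (hκ : ContDiff ℝ ∞ κ) (hκc : HasCompactSupport κ) (hκT : tsupport κ ⊆ Iio 0)
    {g : EuclideanSpace ℝ (Fin 3) → ℝ} (hg : IsTestFunctionOn (⊤ : Opens (EuclideanSpace ℝ (Fin 3))) g) :
    ∫ z : ℝ × EuclideanSpace ℝ (Fin 3), κ z.1 * ⟪u z.1 z.2, gradient g z.2⟫ = 0 := by
  -- adapted from `AntiMember.integral_deriv_mul_inner_eq_zero_of_negPair` step (i)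
  have hg' : IsTestFunctionOn (⟨univ, isOpen_univ⟩ : Opens (EuclideanSpace ℝ (Fin 3))) g :=
    ⟨hg.contDiff, hg.hasCompactSupport, fun _ _ => trivial⟩
  have hΘ : IsSpaceTimeTestOn (slab (EuclideanSpace ℝ (Fin 3)) (Iio 0) isOpen_Iio) (fun t x => κ t • g x) :=
    isSpaceTimeTestOn_prod_smul isOpen_Iio isOpen_univ hκ hκc hκT hg'
  have H := hdist.2.2.2.1 _ hΘ
  have hgd : Differentiable ℝ g := hg.contDiff.differentiable (by simp)
  have hpt : ∀ z : ℝ × EuclideanSpace ℝ (Fin 3),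
      ⟪u z.1 z.2, gradient (fun x => κ z.1 • g x) z.2⟫ = κ z.1 * ⟪u z.1 z.2, gradient g z.2⟫ := by
    intro z
    have e : (fun x => κ z.1 • g x) = fun x => κ z.1 * g x := rfl
    rw [e, ClockRigidity.gradient_const_mul' (hgd z.2), real_inner_smul_right]
  have hvan : ∀ z : ℝ × EuclideanSpace ℝ (Fin 3), z ∉ Iio (0 : ℝ) ×ˢ (univ : Set (EuclideanSpace ℝ (Fin 3))) →
      κ z.1 * ⟪u z.1 z.2, gradient g z.2⟫ = 0 := by
    intro z hz
    have ht : (0 : ℝ) ≤ z.1 := by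
      by_contra h
      exact hz ⟨not_le.1 h, mem_univ _⟩
    rw [AntiMember.eq_zero_of_tsupport_subset_Iio hκT ht, zero_mul]
  have H' : ∫ z in Iio (0 : ℝ) ×ˢ (univ : Set (EuclideanSpace ℝ (Fin 3))), κ z.1 * ⟪u z.1 z.2, gradient g z.2⟫ = 0 := by
    refine Eq.trans ?_ H
    rw [coe_slab]
    exact setIntegral_congr_fun (measurableSet_Iio.prod MeasurableSet.univ) (fun z _ => (hpt z).symm)
  rwa [setIntegral_eq_integral_of_forall_compl_eq_zero hvan] at H'

/-- **CURL-FREE TIME-TESTED FIELD ⇒ `∫∫ κ⟪u, Φ⟫ = 0`** (member level, `A`-gauge `a^{2ρ} A(a) ≤ c`, `ρ > −1`, any smooth cutoff `κ` compactly supported in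
`(−∞,T₁)`, `T₁ ≤ 0`): if `∫∫ κ(t)⟪u, (∂ₐg)c − (∂_c g)a⟫ = 0` for all tests `g` and vectors `a, c`, then `∫∫ κ(t)⟪u(t,x), Φ(x)⟫ = 0` for every continuous
compactly supported `Φ`. [folklore] -/
theorem integral_mul_inner_eq_zero_of_curlFree {ρ : ℝ} (hρ : -1 < ρ)
    {p : ℝ → EuclideanSpace ℝ (Fin 3) → ℝ} {c : ℝ≥0}
    (hsw : IsSuitableWeakSolutionOn (slab (EuclideanSpace ℝ (Fin 3)) (Iio 0) isOpen_Iio) 0 0 u p)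
    (hA : ∀ a : ℝ, 0 < a → ENNReal.ofReal (a ^ (2 * ρ)) * cknA a (0 : ℝ × EuclideanSpace ℝ (Fin 3)) u ≤ (c : ℝ≥0∞))
    {T₁ : ℝ} (hT₁ : T₁ ≤ 0) {κ : ℝ → ℝ} (hκ : ContDiff ℝ ∞ κ) (hκc : HasCompactSupport κ) (hκT₁ : tsupport κ ⊆ Iio T₁)
    (hcurl : ∀ g : EuclideanSpace ℝ (Fin 3) → ℝ, IsTestFunctionOn (⊤ : Opens (EuclideanSpace ℝ (Fin 3))) g → ∀ a b : EuclideanSpace ℝ (Fin 3),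
      ∫ z : ℝ × EuclideanSpace ℝ (Fin 3), κ z.1 * ⟪u z.1 z.2, fderiv ℝ g z.2 a • b - fderiv ℝ g z.2 b • a⟫ = 0)
    {Φ : EuclideanSpace ℝ (Fin 3) → EuclideanSpace ℝ (Fin 3)} (hΦ : Continuous Φ) (hΦc : HasCompactSupport Φ) :
    ∫ z : ℝ × EuclideanSpace ℝ (Fin 3), κ z.1 * ⟪u z.1 z.2, Φ z.2⟫ = 0 := by
  have hdist := hsw.distributional
  have hκT : tsupport κ ⊆ Iio 0 := hκT₁.trans (Iio_subset_Iio hT₁)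
  have hu : LocallyIntegrableOn (uncurry u) (Iio 0 ×ˢ (univ : Set (EuclideanSpace ℝ (Fin 3)))) volume := by
    simpa only [coe_slab] using hdist.1
  have hdiv : ∀ g : EuclideanSpace ℝ (Fin 3) → ℝ, IsTestFunctionOn (⊤ : Opens (EuclideanSpace ℝ (Fin 3))) g →
      ∫ z : ℝ × EuclideanSpace ℝ (Fin 3), κ z.1 * ⟪u z.1 z.2, gradient g z.2⟫ = 0 :=
    fun g hg => integral_mul_inner_gradient_eq_zero hdist hκ hκc hκT hg
  obtain ⟨K, r₀, hgrowth⟩ := growth_of_gaugeA (c := c) hu.aestronglyMeasurable hA hT₁ hκ.continuous hκc hκT₁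
  have hm : 1 - 2 * ρ < 3 := by linarith
  have hw0 := AntiMember.timeTested_ae_eq_zero hu hκ.continuous hκc hκT hdiv hcurl hm hgrowth
  rw [← AntiMember.integral_inner_timeTested hu hκ.continuous hκc hκT hΦ hΦc]
  have : (fun x => ⟪(∫ t, κ t • u t x), Φ x⟫) =ᵐ[volume] fun _ => (0 : ℝ) := by
    filter_upwards [hw0] with x hx
    rw [hx]; simp
  rw [integral_congr_ae this, integral_zero]

/-- **KILLING (SYMMETRIC-PAIR-FREE) TIME-TESTED FIELD ⇒ `∫∫ κ⟪u, Φ⟫ = 0`**: the same with symmetric pairs `(∂ₐg)c + (∂_c g)a`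
(`FrozenStrain.timeTested_ae_eq_zero_of_symPair`, hand g3). [folklore] -/
theorem integral_mul_inner_eq_zero_of_symFree {ρ : ℝ} (hρ : -1 < ρ)
    {p : ℝ → EuclideanSpace ℝ (Fin 3) → ℝ} {c : ℝ≥0}
    (hsw : IsSuitableWeakSolutionOn (slab (EuclideanSpace ℝ (Fin 3)) (Iio 0) isOpen_Iio) 0 0 u p)
    (hA : ∀ a : ℝ, 0 < a → ENNReal.ofReal (a ^ (2 * ρ)) * cknA a (0 : ℝ × EuclideanSpace ℝ (Fin 3)) u ≤ (c : ℝ≥0∞))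
    {T₁ : ℝ} (hT₁ : T₁ ≤ 0) {κ : ℝ → ℝ} (hκ : ContDiff ℝ ∞ κ) (hκc : HasCompactSupport κ) (hκT₁ : tsupport κ ⊆ Iio T₁)
    (hsym : ∀ g : EuclideanSpace ℝ (Fin 3) → ℝ, IsTestFunctionOn (⊤ : Opens (EuclideanSpace ℝ (Fin 3))) g → ∀ a b : EuclideanSpace ℝ (Fin 3),
      ∫ z : ℝ × EuclideanSpace ℝ (Fin 3), κ z.1 * ⟪u z.1 z.2, fderiv ℝ g z.2 a • b + fderiv ℝ g z.2 b • a⟫ = 0)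
    {Φ : EuclideanSpace ℝ (Fin 3) → EuclideanSpace ℝ (Fin 3)} (hΦ : Continuous Φ) (hΦc : HasCompactSupport Φ) :
    ∫ z : ℝ × EuclideanSpace ℝ (Fin 3), κ z.1 * ⟪u z.1 z.2, Φ z.2⟫ = 0 := by
  have hdist := hsw.distributional
  have hκT : tsupport κ ⊆ Iio 0 := hκT₁.trans (Iio_subset_Iio hT₁)
  have hu : LocallyIntegrableOn (uncurry u) (Iio 0 ×ˢ (univ : Set (EuclideanSpace ℝ (Fin 3)))) volume := by
    simpa only [coe_slab] using hdist.1
  obtain ⟨K, r₀, hgrowth⟩ := growth_of_gaugeA (c := c) hu.aestronglyMeasurable hA hT₁ hκ.continuous hκc hκT₁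
  have hm : 1 - 2 * ρ < 3 := by linarith
  have hw0 := FrozenStrain.timeTested_ae_eq_zero_of_symPair hu hκ.continuous hκc hκT hsym hm hgrowth
  rw [← AntiMember.integral_inner_timeTested hu hκ.continuous hκc hκT hΦ hΦc]
  have : (fun x => ⟪(∫ t, κ t • u t x), Φ x⟫) =ᵐ[volume] fun _ => (0 : ℝ) := by
    filter_upwards [hw0] with x hx
    rw [hx]; simp
  rw [integral_congr_ae this, integral_zero]

end TimeTested

/-! ## Member level: polynomial vorticity / strain / Lamb term -/

section Member

variable {ρ : ℝ} {u : ℝ → EuclideanSpace ℝ (Fin 3) → EuclideanSpace ℝ (Fin 3)} {p : ℝ → EuclideanSpace ℝ (Fin 3) → ℝ}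
  {H : ℝ → EuclideanSpace ℝ (Fin 3) → EuclideanSpace ℝ (Fin 3) →L[ℝ] EuclideanSpace ℝ (Fin 3)} {c : ℝ≥0} {T₁ : ℝ}

/-- **VORTICITY POLYNOMIAL IN TIME IN `𝒟'` ⇒ TRIVIAL** (every `ρ > 0`, any degree `N`): crux hypotheses verbatim, `T₁ ≤ 0`, and
`∫∫ θ^{(N+1)}(t) ⟪u, (∂ₐg)c − (∂_c g)a⟫ = 0` for all `θ ∈ C_c^∞((−∞,T₁))`, tests `g`, vectors `a, c` (`∂ₜ^{N+1}ω = 0` in `𝒟'`) ⇒ `u = 0` a.e.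
(`N = 0`: frozen vorticity, hand g3; `N = 1`: `…AffineVorticityMember`). [folklore] -/
theorem Loc.ae_eq_zero_of_distributionallyPolynomialVorticityPast (hρ : 0 < ρ)
    (hsw : IsSuitableWeakSolutionOn (slab (EuclideanSpace ℝ (Fin 3)) (Iio 0) isOpen_Iio) 0 0 u p)
    (hH : HasWeakSpatialGradientOn (slab (EuclideanSpace ℝ (Fin 3)) (Iio 0) isOpen_Iio) u H)
    (hc : ∀ a : ℝ, 0 < a → ENNReal.ofReal (a ^ (2 * ρ)) * cknA a (0 : ℝ × EuclideanSpace ℝ (Fin 3)) u +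
        ENNReal.ofReal (a ^ ρ) * cknE a (0 : ℝ × EuclideanSpace ℝ (Fin 3)) H +
        ENNReal.ofReal (a ^ (2 * ρ)) * cknD a (0 : ℝ × EuclideanSpace ℝ (Fin 3)) p ≤ (c : ℝ≥0∞))
    (hT₁ : T₁ ≤ 0) (N : ℕ)
    (hvort : ∀ θ : ℝ → ℝ, ContDiff ℝ ∞ θ → HasCompactSupport θ → tsupport θ ⊆ Iio T₁ →
      ∀ g : EuclideanSpace ℝ (Fin 3) → ℝ, IsTestFunctionOn (⊤ : Opens (EuclideanSpace ℝ (Fin 3))) g → ∀ a b : EuclideanSpace ℝ (Fin 3),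
        ∫ z : ℝ × EuclideanSpace ℝ (Fin 3), deriv^[N + 1] θ z.1 * ⟪u z.1 z.2, fderiv ℝ g z.2 a • b - fderiv ℝ g z.2 b • a⟫ = 0) :
    uncurry u =ᵐ[volume.restrict (Iio (0 : ℝ) ×ˢ (univ : Set (EuclideanSpace ℝ (Fin 3))))] 0 := by
  have hA : ∀ a : ℝ, 0 < a → ENNReal.ofReal (a ^ (2 * ρ)) *
      cknA a (0 : ℝ × EuclideanSpace ℝ (Fin 3)) u ≤ (c : ℝ≥0∞) :=
    fun a ha => le_trans (le_trans le_self_add le_self_add) (hc a ha)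
  exact Loc.ae_eq_zero_of_distributionallyPolynomialPast hρ hsw hH hc hT₁ N fun θ hθ hθc hθT Φ hΦ hΦc =>
    TimeTested.integral_mul_inner_eq_zero_of_curlFree (by linarith) hsw hA hT₁ (hθ.iterate_deriv (N + 1))
      (DistPoly.hasCompactSupport_iterate_deriv hθc (N + 1)) ((DistPoly.tsupport_iterate_deriv_subset (N + 1)).trans hθT)
      (hvort θ hθ hθc hθT) hΦ hΦc

/-- **`∂ₜ^{N+1}(H − Hᵀ) = 0` IN `𝒟'` ⇒ TRIVIAL** (`H`-form): `∫ dt ∫ dx θ^{(N+1)}(t) g(x) (⟪H a, c⟫ − ⟪H c, a⟫) = 0` for all `θ, g, a, c`. [folklore] -/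
theorem Loc.ae_eq_zero_of_polynomialWeakGradientCurl (hρ : 0 < ρ)
    (hsw : IsSuitableWeakSolutionOn (slab (EuclideanSpace ℝ (Fin 3)) (Iio 0) isOpen_Iio) 0 0 u p)
    (hH : HasWeakSpatialGradientOn (slab (EuclideanSpace ℝ (Fin 3)) (Iio 0) isOpen_Iio) u H)
    (hc : ∀ a : ℝ, 0 < a → ENNReal.ofReal (a ^ (2 * ρ)) * cknA a (0 : ℝ × EuclideanSpace ℝ (Fin 3)) u +
        ENNReal.ofReal (a ^ ρ) * cknE a (0 : ℝ × EuclideanSpace ℝ (Fin 3)) H +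
        ENNReal.ofReal (a ^ (2 * ρ)) * cknD a (0 : ℝ × EuclideanSpace ℝ (Fin 3)) p ≤ (c : ℝ≥0∞))
    (hT₁ : T₁ ≤ 0) (N : ℕ)
    (hpolyH : ∀ θ : ℝ → ℝ, ContDiff ℝ ∞ θ → HasCompactSupport θ → tsupport θ ⊆ Iio T₁ →
      ∀ g : EuclideanSpace ℝ (Fin 3) → ℝ, IsTestFunctionOn (⊤ : Opens (EuclideanSpace ℝ (Fin 3))) g → ∀ a c : EuclideanSpace ℝ (Fin 3),
        ∫ t, ∫ x, deriv^[N + 1] θ t * g x * (⟪H t x a, c⟫ - ⟪H t x c, a⟫) = 0) :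
    uncurry u =ᵐ[volume.restrict (Iio (0 : ℝ) ×ˢ (univ : Set (EuclideanSpace ℝ (Fin 3))))] 0 := by
  refine Loc.ae_eq_zero_of_distributionallyPolynomialVorticityPast hρ hsw hH hc hT₁ N fun θ hθ hθc hθT g hg a c' => ?_
  have hθT0 : tsupport θ ⊆ Iio 0 := hθT.trans (Iio_subset_Iio hT₁)
  rw [AffineCurl.integral_mul_inner_curlPair_eq hH (hθ.iterate_deriv (N + 1)) (DistPoly.hasCompactSupport_iterate_deriv hθc (N + 1))
    ((DistPoly.tsupport_iterate_deriv_subset (N + 1)).trans hθT0) hg a c', hpolyH θ hθ hθc hθT g hg a c', neg_zero]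

/-- **STRAIN POLYNOMIAL IN TIME IN `𝒟'` ⇒ TRIVIAL** (every `ρ > 0`, any degree `N`): `∫∫ θ^{(N+1)}(t) ⟪u, (∂ₐg)c + (∂_c g)a⟫ = 0` for all
`θ ∈ C_c^∞((−∞,T₁))`, tests `g`, vectors `a, c` (`∂ₜ^{N+1}(H + Hᵀ) = 0` in `𝒟'`) ⇒ `u = 0` a.e. [folklore] -/
theorem Loc.ae_eq_zero_of_distributionallyPolynomialStrainPast (hρ : 0 < ρ)
    (hsw : IsSuitableWeakSolutionOn (slab (EuclideanSpace ℝ (Fin 3)) (Iio 0) isOpen_Iio) 0 0 u p)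
    (hH : HasWeakSpatialGradientOn (slab (EuclideanSpace ℝ (Fin 3)) (Iio 0) isOpen_Iio) u H)
    (hc : ∀ a : ℝ, 0 < a → ENNReal.ofReal (a ^ (2 * ρ)) * cknA a (0 : ℝ × EuclideanSpace ℝ (Fin 3)) u +
        ENNReal.ofReal (a ^ ρ) * cknE a (0 : ℝ × EuclideanSpace ℝ (Fin 3)) H +
        ENNReal.ofReal (a ^ (2 * ρ)) * cknD a (0 : ℝ × EuclideanSpace ℝ (Fin 3)) p ≤ (c : ℝ≥0∞))
    (hT₁ : T₁ ≤ 0) (N : ℕ)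
    (hsym : ∀ θ : ℝ → ℝ, ContDiff ℝ ∞ θ → HasCompactSupport θ → tsupport θ ⊆ Iio T₁ →
      ∀ g : EuclideanSpace ℝ (Fin 3) → ℝ, IsTestFunctionOn (⊤ : Opens (EuclideanSpace ℝ (Fin 3))) g → ∀ a b : EuclideanSpace ℝ (Fin 3),
        ∫ z : ℝ × EuclideanSpace ℝ (Fin 3), deriv^[N + 1] θ z.1 * ⟪u z.1 z.2, fderiv ℝ g z.2 a • b + fderiv ℝ g z.2 b • a⟫ = 0) :
    uncurry u =ᵐ[volume.restrict (Iio (0 : ℝ) ×ˢ (univ : Set (EuclideanSpace ℝ (Fin 3))))] 0 := by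
  have hA : ∀ a : ℝ, 0 < a → ENNReal.ofReal (a ^ (2 * ρ)) *
      cknA a (0 : ℝ × EuclideanSpace ℝ (Fin 3)) u ≤ (c : ℝ≥0∞) :=
    fun a ha => le_trans (le_trans le_self_add le_self_add) (hc a ha)
  exact Loc.ae_eq_zero_of_distributionallyPolynomialPast hρ hsw hH hc hT₁ N fun θ hθ hθc hθT Φ hΦ hΦc =>
    TimeTested.integral_mul_inner_eq_zero_of_symFree (by linarith) hsw hA hT₁ (hθ.iterate_deriv (N + 1))
      (DistPoly.hasCompactSupport_iterate_deriv hθc (N + 1)) ((DistPoly.tsupport_iterate_deriv_subset (N + 1)).trans hθT)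
      (hsym θ hθ hθc hθT) hΦ hΦc

/-- **`∂ₜ^{N+1}(H + Hᵀ) = 0` IN `𝒟'` ⇒ TRIVIAL** (`H`-form): `∫ dt ∫ dx θ^{(N+1)}(t) g(x) (⟪H a, c⟫ + ⟪H c, a⟫) = 0` for all `θ, g, a, c`. [folklore] -/
theorem Loc.ae_eq_zero_of_polynomialWeakGradientSym (hρ : 0 < ρ)
    (hsw : IsSuitableWeakSolutionOn (slab (EuclideanSpace ℝ (Fin 3)) (Iio 0) isOpen_Iio) 0 0 u p)
    (hH : HasWeakSpatialGradientOn (slab (EuclideanSpace ℝ (Fin 3)) (Iio 0) isOpen_Iio) u H)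
    (hc : ∀ a : ℝ, 0 < a → ENNReal.ofReal (a ^ (2 * ρ)) * cknA a (0 : ℝ × EuclideanSpace ℝ (Fin 3)) u +
        ENNReal.ofReal (a ^ ρ) * cknE a (0 : ℝ × EuclideanSpace ℝ (Fin 3)) H +
        ENNReal.ofReal (a ^ (2 * ρ)) * cknD a (0 : ℝ × EuclideanSpace ℝ (Fin 3)) p ≤ (c : ℝ≥0∞))
    (hT₁ : T₁ ≤ 0) (N : ℕ)
    (hpolyH : ∀ θ : ℝ → ℝ, ContDiff ℝ ∞ θ → HasCompactSupport θ → tsupport θ ⊆ Iio T₁ →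
      ∀ g : EuclideanSpace ℝ (Fin 3) → ℝ, IsTestFunctionOn (⊤ : Opens (EuclideanSpace ℝ (Fin 3))) g → ∀ a c : EuclideanSpace ℝ (Fin 3),
        ∫ t, ∫ x, deriv^[N + 1] θ t * g x * (⟪H t x a, c⟫ + ⟪H t x c, a⟫) = 0) :
    uncurry u =ᵐ[volume.restrict (Iio (0 : ℝ) ×ˢ (univ : Set (EuclideanSpace ℝ (Fin 3))))] 0 := by
  refine Loc.ae_eq_zero_of_distributionallyPolynomialStrainPast hρ hsw hH hc hT₁ N fun θ hθ hθc hθT g hg a c' => ?_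
  have hθT0 : tsupport θ ⊆ Iio 0 := hθT.trans (Iio_subset_Iio hT₁)
  rw [AffineSym.integral_mul_inner_symPair_eq hH (hθ.iterate_deriv (N + 1)) (DistPoly.hasCompactSupport_iterate_deriv hθc (N + 1))
    ((DistPoly.tsupport_iterate_deriv_subset (N + 1)).trans hθT0) hg a c', hpolyH θ hθ hθc hθT g hg a c', neg_zero]

/-- **LAMB TERM POLYNOMIAL IN TIME IN `𝒟'` ⇒ TRIVIAL** (every `ρ > 0`, any degree): crux hypotheses verbatim, `T₁ ≤ 0`, and the velocity-tested advection
polynomial of degree `≤ N` in `𝒟'((−∞,T₁))` on curl pairs — `∫∫ θ^{(N+1)}(t) ⟪u, Dη[u]⟫ = 0` for all `θ ∈ C_c^∞((−∞,T₁))` and all `η = (∂ₐg)b − (∂_b g)a` —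
⇒ `u = 0` a.e. (the momentum identity tested with `θ^{(N+1)}(t)η(x)` gives `∂ₜ^{N+2}ω = 0` in `𝒟'`).  `N = 0`: `…FrozenLambMember`. [folklore] -/
theorem Loc.ae_eq_zero_of_polynomialLambCurlPast (hρ : 0 < ρ)
    (hsw : IsSuitableWeakSolutionOn (slab (EuclideanSpace ℝ (Fin 3)) (Iio 0) isOpen_Iio) 0 0 u p)
    (hH : HasWeakSpatialGradientOn (slab (EuclideanSpace ℝ (Fin 3)) (Iio 0) isOpen_Iio) u H)
    (hc : ∀ a : ℝ, 0 < a → ENNReal.ofReal (a ^ (2 * ρ)) * cknA a (0 : ℝ × EuclideanSpace ℝ (Fin 3)) u +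
        ENNReal.ofReal (a ^ ρ) * cknE a (0 : ℝ × EuclideanSpace ℝ (Fin 3)) H +
        ENNReal.ofReal (a ^ (2 * ρ)) * cknD a (0 : ℝ × EuclideanSpace ℝ (Fin 3)) p ≤ (c : ℝ≥0∞))
    (hT₁ : T₁ ≤ 0) (N : ℕ)
    (hLamb : ∀ θ : ℝ → ℝ, ContDiff ℝ ∞ θ → HasCompactSupport θ → tsupport θ ⊆ Iio T₁ →
      ∀ g : EuclideanSpace ℝ (Fin 3) → ℝ, IsTestFunctionOn (⊤ : Opens (EuclideanSpace ℝ (Fin 3))) g → ∀ a b : EuclideanSpace ℝ (Fin 3),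
        ∫ z : ℝ × EuclideanSpace ℝ (Fin 3), deriv^[N + 1] θ z.1 *
          ⟪u z.1 z.2, fderiv ℝ (fun x => fderiv ℝ g x a • b - fderiv ℝ g x b • a) z.2 (u z.1 z.2)⟫ = 0) :
    uncurry u =ᵐ[volume.restrict (Iio (0 : ℝ) ×ˢ (univ : Set (EuclideanSpace ℝ (Fin 3))))] 0 := by
  have hdist := hsw.distributional
  refine Loc.ae_eq_zero_of_distributionallyPolynomialVorticityPast hρ hsw hH hc hT₁ (N + 1) fun θ hθ hθc hθT g hg a b => ?_
  -- the momentum identity tested with `θ^{(N+1)}(t) η(x)`, `η` the (divergence-free) curl pair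
  have hη := isTestFunctionOn_curlPair hg a b
  have hdiv := isDivFree_curlPair_of_contDiff (hg.contDiff.of_le (by norm_cast)) a b
  have hθT0 : tsupport θ ⊆ Iio 0 := hθT.trans (Iio_subset_Iio hT₁)
  have hκ : ContDiff ℝ ∞ (deriv^[N + 1] θ) := hθ.iterate_deriv (N + 1)
  have hκc : HasCompactSupport (deriv^[N + 1] θ) := DistPoly.hasCompactSupport_iterate_deriv hθc (N + 1)
  have hκT : tsupport (deriv^[N + 1] θ) ⊆ Iio 0 := (DistPoly.tsupport_iterate_deriv_subset (N + 1)).trans hθT0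
  have H1 := AntiMember.momentum_tensor hdist hκ hκc hκT hη hdiv
  have H2 := hLamb θ hθ hθc hθT g hg a b
  obtain ⟨hκ2, hκ2c, hκ2T⟩ := AntiMember.deriv_cutoff_props hκ hκc hκT
  have hu : LocallyIntegrableOn (uncurry u) (Iio 0 ×ˢ (univ : Set (EuclideanSpace ℝ (Fin 3)))) volume := by
    simpa only [coe_slab] using hdist.1
  have hum : AEStronglyMeasurable (uncurry u) (volume.restrict (Iio (0 : ℝ) ×ˢ (univ : Set (EuclideanSpace ℝ (Fin 3))))) :=
    hu.aestronglyMeasurable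
  have hu2 : LocallyIntegrableOn (fun z => ‖uncurry u z‖ ^ 2) (Iio (0 : ℝ) ×ˢ (univ : Set (EuclideanSpace ℝ (Fin 3)))) volume := by
    simpa only [coe_slab] using hdist.2.1
  have iA := AntiMember.integrable_mul_inner_field hu hκ2 hκ2c hκ2T hη.contDiff.continuous hη.hasCompactSupport
  have iB := AntiMember.integrable_mul_inner_fderiv_apply hum hu2 hκ.continuous hκc hκT (hη.contDiff.of_le (by norm_cast)) hη.hasCompactSupport
  rw [integral_add iA iB, H2, add_zero] at H1
  rwa [← Function.iterate_succ_apply' deriv (N + 1) θ] at H1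

end Member

/-! ## Binder language -/

/-- **Binder language: NO MEMBER HAS VORTICITY POLYNOMIAL IN TIME (IN `𝒟'`) IN ITS FAR PAST**: some `T₁ ≤ 0`, some `N`,
`∫∫ θ^{(N+1)}⟪u, (∂ₐg)c − (∂_c g)a⟫ = 0` for all `θ ∈ C_c^∞((−∞,T₁))`, `g`, `a`, `c` ⇒ trivial. [folklore] -/
theorem Birth.nonSelfSimilar_of_distributionallyPolynomialVorticityPast :
    ∀ ρ : ℝ, 0 < ρ →
      ∀ (u : ℝ → EuclideanSpace ℝ (Fin 3) → EuclideanSpace ℝ (Fin 3)) (p : ℝ → EuclideanSpace ℝ (Fin 3) → ℝ)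
        (H : ℝ → EuclideanSpace ℝ (Fin 3) → EuclideanSpace ℝ (Fin 3) →L[ℝ] EuclideanSpace ℝ (Fin 3)) (c : ℝ≥0),
        Birth.InClass ρ u p H c →
          (∃ T₁ : ℝ, T₁ ≤ 0 ∧ ∃ N : ℕ, ∀ θ : ℝ → ℝ, ContDiff ℝ ∞ θ → HasCompactSupport θ → tsupport θ ⊆ Iio T₁ →
              ∀ g : EuclideanSpace ℝ (Fin 3) → ℝ, IsTestFunctionOn (⊤ : Opens (EuclideanSpace ℝ (Fin 3))) g → ∀ a b : EuclideanSpace ℝ (Fin 3),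
                ∫ z : ℝ × EuclideanSpace ℝ (Fin 3), deriv^[N + 1] θ z.1 * ⟪u z.1 z.2, fderiv ℝ g z.2 a • b - fderiv ℝ g z.2 b • a⟫ = 0) →
          uncurry u =ᵐ[volume.restrict (Iio (0 : ℝ) ×ˢ (univ : Set (EuclideanSpace ℝ (Fin 3))))] 0 := by
  intro ρ hρ u p H c hcl h
  obtain ⟨T₁, hT₁, N, hv⟩ := h
  exact Loc.ae_eq_zero_of_distributionallyPolynomialVorticityPast hρ hcl.1 hcl.2.1 hcl.2.2 hT₁ N hv

/-- **Binder language: NO MEMBER HAS STRAIN POLYNOMIAL IN TIME (IN `𝒟'`) IN ITS FAR PAST**. [folklore] -/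
theorem Birth.nonSelfSimilar_of_distributionallyPolynomialStrainPast :
    ∀ ρ : ℝ, 0 < ρ →
      ∀ (u : ℝ → EuclideanSpace ℝ (Fin 3) → EuclideanSpace ℝ (Fin 3)) (p : ℝ → EuclideanSpace ℝ (Fin 3) → ℝ)
        (H : ℝ → EuclideanSpace ℝ (Fin 3) → EuclideanSpace ℝ (Fin 3) →L[ℝ] EuclideanSpace ℝ (Fin 3)) (c : ℝ≥0),
        Birth.InClass ρ u p H c →
          (∃ T₁ : ℝ, T₁ ≤ 0 ∧ ∃ N : ℕ, ∀ θ : ℝ → ℝ, ContDiff ℝ ∞ θ → HasCompactSupport θ → tsupport θ ⊆ Iio T₁ →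
              ∀ g : EuclideanSpace ℝ (Fin 3) → ℝ, IsTestFunctionOn (⊤ : Opens (EuclideanSpace ℝ (Fin 3))) g → ∀ a b : EuclideanSpace ℝ (Fin 3),
                ∫ z : ℝ × EuclideanSpace ℝ (Fin 3), deriv^[N + 1] θ z.1 * ⟪u z.1 z.2, fderiv ℝ g z.2 a • b + fderiv ℝ g z.2 b • a⟫ = 0) →
          uncurry u =ᵐ[volume.restrict (Iio (0 : ℝ) ×ˢ (univ : Set (EuclideanSpace ℝ (Fin 3))))] 0 := by
  intro ρ hρ u p H c hcl h
  obtain ⟨T₁, hT₁, N, hs⟩ := h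
  exact Loc.ae_eq_zero_of_distributionallyPolynomialStrainPast hρ hcl.1 hcl.2.1 hcl.2.2 hT₁ N hs

/-- **Binder language: NO MEMBER HAS A LAMB TERM POLYNOMIAL IN TIME (IN `𝒟'`) IN ITS FAR PAST**: some `T₁ ≤ 0`, some `N`, velocity-tested advection
polynomial of degree `≤ N` in `𝒟'((−∞,T₁))` on curl pairs ⇒ trivial. [folklore] -/
theorem Birth.nonSelfSimilar_of_polynomialLambCurlPast :
    ∀ ρ : ℝ, 0 < ρ →
      ∀ (u : ℝ → EuclideanSpace ℝ (Fin 3) → EuclideanSpace ℝ (Fin 3)) (p : ℝ → EuclideanSpace ℝ (Fin 3) → ℝ)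
        (H : ℝ → EuclideanSpace ℝ (Fin 3) → EuclideanSpace ℝ (Fin 3) →L[ℝ] EuclideanSpace ℝ (Fin 3)) (c : ℝ≥0),
        Birth.InClass ρ u p H c →
          (∃ T₁ : ℝ, T₁ ≤ 0 ∧ ∃ N : ℕ, ∀ θ : ℝ → ℝ, ContDiff ℝ ∞ θ → HasCompactSupport θ → tsupport θ ⊆ Iio T₁ →
              ∀ g : EuclideanSpace ℝ (Fin 3) → ℝ, IsTestFunctionOn (⊤ : Opens (EuclideanSpace ℝ (Fin 3))) g → ∀ a b : EuclideanSpace ℝ (Fin 3),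
                ∫ z : ℝ × EuclideanSpace ℝ (Fin 3), deriv^[N + 1] θ z.1 *
                  ⟪u z.1 z.2, fderiv ℝ (fun x => fderiv ℝ g x a • b - fderiv ℝ g x b • a) z.2 (u z.1 z.2)⟫ = 0) →
          uncurry u =ᵐ[volume.restrict (Iio (0 : ℝ) ×ˢ (univ : Set (EuclideanSpace ℝ (Fin 3))))] 0 := by
  intro ρ hρ u p H c hcl h
  obtain ⟨T₁, hT₁, N, hL⟩ := h
  exact Loc.ae_eq_zero_of_polynomialLambCurlPast hρ hcl.1 hcl.2.1 hcl.2.2 hT₁ N hL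

end Summit.NavierStokesRegularity.NavierStokesRegularity.Theorems.PowerGaugeEulerLiouville

end
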